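import Literature.MathematicalPhysics.QuantumFieldTheory.Balaban1983to89.Node00.ROperationOfRecordForm

/-!
# NODE 00 — DEFINER ₇ (R-side), FILE 10: the (0.3) provisos of the R-step data OF RECORD, REDUCED TO DISPLAYED SLOT PROPERTIES

The NODE 00 records carry the (0.3)∕(0.4) provisos of [IV] p. 176 for the tower of record as ONE opaque hypothesis on b01's
representation datum — `(towerRepOfRecord F N ν τ texpA ppSel p g k).toRepData.Provisos` (standard form: denominators nowhere zero) or
`.ProvisosSupp` (dag-n10-b's support form, the reading of record, (R-C2)).  The pieces of that datum are, by `rfl` (FILE 4 `repr218OfRecord`,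
FILE 7 `repDataOfSel` ∕ `rterm`, FILE 8 `toRepData_towerRepOfRecord_eq`), the (2.18) summands `χ_k(s)(V) · (𝐓_k(s) exp A_k(s))(V)` —
`chiSeqOfRecord F N ν τ.M g p.K k s V * texpA p g k s V` — the `Z ↦ Z″` map is the residual selector `ppSel p g k`, and the fibre bond sets
are `fibOfSeq F ν τ p g k s`.  THIS FILE writes both proviso forms OUT in those displayed terms (`Iff.rfl`), and gives the SUFFICIENT displayed
conditions on the factors separately — measurability of `χ_k(s)` and of the slot, `0 ≤ slot ≤ C`, and the support clause *«where the
denominator fibre integral of the selected summand vanishes, `χ_k(s)(V) = 0` or the slot vanishes»* — using `0 ≤ χ_k(s) ≤ 1` (a product of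
0∕1 characteristic functions, `chi218_nonneg` ∕ `chi218_le_one`); composed with FILE 9′, the (0.4) identity and the integrability of the
R-stepped slice density AT A SLOT FAMILY follow from the displayed slot properties alone (`…_of_slots`).  So a ₉ record may DISPLAY its
`rstep` proviso instead of carrying it opaque (dag-ref-B's «displayed residual», pub-ymgap INBOX l.10669; node00-def-T `Record9` §3).

THE ZERO-SLOT BOOKKEEPING PAIR (for plan's K0 «inhabited by bookkeeping» check at ₉, pub-ymgap INBOX l.10686, and (R-C2)): at the ZERO
slot family (`texpA p g k s V = 0` for all `s, V` — a junk inhabitant, no mathematics) every (2.18) summand is the zero function, so the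
SUPPORT-form provisos HOLD (`provisosSupp_towerRepOfRecord_of_slot_eq_zero`: measurable ∕ `0 ≤ 0 ≤ 0` ∕ the support clause concludes
`0 = 0`) while the STANDARD-form provisos FAIL as soon as one sequence and one field exist (`not_provisos_towerRepOfRecord_of_slot_eq_zero`:
the denominator `∫dV′⌈ 0 = 0`, `fibreIntegral_zero_fun`).  This is the vacuity direction only: it says the support-form bundle is not
empty by typing and the standard one is not full by typing; it says nothing about the genuine slots.

NOT DERIVED HERE (honest): measurability of `χ_k(s)` of record — its cubes' small-field tests read def-B's background of record at the
(2.12) minimisers, a classical choice with no measurable selection in the tree — stays a DISPLAYED hypothesis (node00-def-T's `measChi`);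
nothing says the support clause holds for the slots of record (that is [IV] p. 176 *«the integration domains … are nonempty»* at the objects
of record — analysis, not bookkeeping).

HONEST FRAMING.  Bookkeeping identities (`Iff.rfl`) and one elementary sufficient condition; nothing of Bałaban's asserted; counts unmoved;
nothing continuum ∕ ℝ⁴ ∕ OS ∕ mass-gap ∕ Clay.  No `sorry` ∕ `axiom` ∕ `opaque` ∕ `instance` ∕ `notation`.
-/

noncomputable section

namespace Literature.MathematicalPhysics.QuantumFieldTheory.Balaban1983to89.Node00

open MeasureTheory
open scoped BigOperators
open T4Continuum B15RopTotal
open B15.BasicStep (fibreIntegral)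
open B14.Eq218Concrete (chi218_nonneg chi218_le_one)

/-! ## §1  Generic: the provisos of `repDataOfSel r sel fib` written out on the (2.18) summands `t_a = χ(a) · (𝐓 e^{A})(a)` -/

section Generic

variable {P : Params} {j : ℕ} {G : Type*} [GaugeGroup G] [MeasurableSpace G] [HaarData G] [DecidableEq (PBond P j)]

/-- The STANDARD provisos of the R-step datum of a (2.18) representation, written out: measurable, non-negative, uniformly bounded summands
`t_a`, and every denominator fibre integral `∫dV′⌈_{fib a} t_{sel a}` NOWHERE zero. [cite: Balaban1989LargeFieldI, (0.3) p.176] -/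
theorem provisos_repDataOfSel_iff (r : Step.Repr218 P G j) (sel : r.Adm → r.Adm) (fib : r.Adm → Finset (PBond P j)) :
    (repDataOfSel r sel fib).Provisos ↔
      (∀ a, Measurable (rterm r a)) ∧ (∀ a V, 0 ≤ rterm r a V) ∧ (∃ C : ℝ, ∀ a V, rterm r a V ≤ C) ∧
        ∀ a V, fibreIntegral (fib a) (rterm r (sel a)) V ≠ 0 :=
  Iff.rfl

/-- The SUPPORT-form provisos of the R-step datum of a (2.18) representation, written out: measurable, non-negative, uniformly bounded
summands, and *«where the denominator fibre integral `∫dV′⌈_{fib a} t_{sel a}` vanishes, `t_a` vanishes»*. [cite: Balaban1989LargeFieldI, (0.3) p.176] -/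
theorem provisosSupp_repDataOfSel_iff (r : Step.Repr218 P G j) (sel : r.Adm → r.Adm) (fib : r.Adm → Finset (PBond P j)) :
    (repDataOfSel r sel fib).ProvisosSupp ↔
      (∀ a, Measurable (rterm r a)) ∧ (∀ a V, 0 ≤ rterm r a V) ∧ (∃ C : ℝ, ∀ a V, rterm r a V ≤ C) ∧
        ∀ a V, fibreIntegral (fib a) (rterm r (sel a)) V = 0 → rterm r a V = 0 :=
  Iff.rfl

/-- **SUFFICIENT DISPLAYED CONDITIONS ON THE FACTORS**: `χ(a)` and the slot `(𝐓 e^{A})(a)` measurable, `0 ≤ χ(a) ≤ 1`, `0 ≤ slot ≤ C`, and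
the support clause on the factors give the support-form provisos of the R-step datum. [cite: Balaban1989LargeFieldI, (0.3) p.176; Balaban1988Convergent, (2.17)–(2.18) p.257] -/
theorem provisosSupp_repDataOfSel_of_factors (r : Step.Repr218 P G j) (sel : r.Adm → r.Adm) (fib : r.Adm → Finset (PBond P j))
    (hχm : ∀ a, Measurable (r.χ a)) (hTm : ∀ a, Measurable (r.TexpA a))
    (hχ0 : ∀ a V, 0 ≤ r.χ a V) (hχ1 : ∀ a V, r.χ a V ≤ 1)
    (hT0 : ∀ a V, 0 ≤ r.TexpA a V) (hTC : ∃ C : ℝ, ∀ a V, r.TexpA a V ≤ C)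
    (hsupp : ∀ a V, fibreIntegral (fib a) (rterm r (sel a)) V = 0 → r.χ a V = 0 ∨ r.TexpA a V = 0) :
    (repDataOfSel r sel fib).ProvisosSupp := by
  refine ⟨fun a => (hχm a).mul (hTm a), fun a V => mul_nonneg (hχ0 a V) (hT0 a V), ?_, fun a V h => ?_⟩
  · obtain ⟨C, hC⟩ := hTC
    exact ⟨C, fun a V => (mul_le_of_le_one_left (hT0 a V) (hχ1 a V)).trans (hC a V)⟩
  · show r.χ a V * r.TexpA a V = 0
    rcases hsupp a V h with h0 | h0
    · rw [h0, zero_mul]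
    · rw [h0, mul_zero]

/-- The standard form implies the support form here too (n10-b's `provisosSupp_of_provisos`, restated at the R-step datum for the
consumer's convenience is NOT needed — cite `RepData.provisosSupp_of_provisos` directly); this lemma records only that under the STANDARD
form the support clause's premise is never met. [cite: Balaban1989LargeFieldI, (0.3) p.176 (bookkeeping)] -/
theorem rterm_support_of_provisos (r : Step.Repr218 P G j) (sel : r.Adm → r.Adm) (fib : r.Adm → Finset (PBond P j))
    (h : (repDataOfSel r sel fib).Provisos) (a : r.Adm) (V : GaugeField P j G)
    (h0 : fibreIntegral (fib a) (rterm r (sel a)) V = 0) : rterm r a V = 0 :=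
  absurd h0 (h.2.2.2 a V)

/-- The restricted fibre integral `∫dV′⌈_s` of the zero density is zero. [cite: Balaban1989LargeFieldI, (0.3) p.176 (bookkeeping)] -/
theorem fibreIntegral_zero_fun (s : Finset (PBond P j)) (V : GaugeField P j G) :
    fibreIntegral s (fun _ => (0 : ℝ)) V = 0 := by
  simp [fibreIntegral, MeasureTheory.lmarginal]

omit [MeasurableSpace G] [HaarData G] [DecidableEq (PBond P j)] in
/-- A (2.18) summand with the zero slot is the zero function. [cite: Balaban1988Convergent, (2.18) p.257 (bookkeeping)] -/
theorem rterm_eq_zero_of_TexpA (r : Step.Repr218 P G j) (a : r.Adm) (h0 : ∀ V, r.TexpA a V = 0) :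
    rterm r a = fun _ => 0 :=
  funext fun V => by simp [rterm, h0 V]

/-- **ZERO SLOTS: the SUPPORT-form provisos hold** (every summand is the zero function; bound `C = 0`; the support clause concludes
`0 = 0`) — the junk inhabitant of the support-form bundle. [cite: Balaban1989LargeFieldI, (0.3) p.176 (bookkeeping)] -/
theorem provisosSupp_repDataOfSel_of_TexpA_eq_zero (r : Step.Repr218 P G j) (sel : r.Adm → r.Adm)
    (fib : r.Adm → Finset (PBond P j)) (h0 : ∀ a V, r.TexpA a V = 0) : (repDataOfSel r sel fib).ProvisosSupp := by
  have hz : ∀ a, rterm r a = fun _ => 0 := fun a => rterm_eq_zero_of_TexpA r a (h0 a)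
  refine ⟨fun a => ?_, fun a V => ?_, ⟨0, fun a V => ?_⟩, fun a V _ => ?_⟩
  · show Measurable (rterm r a); rw [hz a]; exact measurable_const
  · show 0 ≤ rterm r a V; rw [hz a]
  · show rterm r a V ≤ 0; rw [hz a]
  · show rterm r a V = 0; rw [hz a]

/-- **ZERO SLOTS: the STANDARD-form provisos fail** as soon as an index `a` and a field `V` exist — the denominator
`∫dV′⌈_{fib a} t_{sel a} = ∫dV′⌈ 0 = 0`. [cite: Balaban1989LargeFieldI, (0.3) p.176 (bookkeeping)] -/
theorem not_provisos_repDataOfSel_of_TexpA_eq_zero (r : Step.Repr218 P G j) (sel : r.Adm → r.Adm)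
    (fib : r.Adm → Finset (PBond P j)) (h0 : ∀ a V, r.TexpA a V = 0) (a : r.Adm) (V : GaugeField P j G) :
    ¬ (repDataOfSel r sel fib).Provisos := by
  intro h
  apply h.2.2.2 a V
  show fibreIntegral (fib a) (rterm r (sel a)) V = 0
  rw [rterm_eq_zero_of_TexpA r (sel a) (h0 (sel a))]
  exact fibreIntegral_zero_fun (fib a) V

end Generic

/-! ## §2  At the objects of record: the tower's R-step data -/

section Record

variable (F : T4Family) (N : ℕ) [NeZero N] (ν : Stage7Numerics)

/-- `0 ≤ χ_k(s)` of record (a product of 0∕1 characteristic functions). [cite: Balaban1988Convergent, (2.17)–(2.18) p.257 (bookkeeping)] -/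
theorem chiSeqOfRecord_nonneg (M : ℕ) (g : ℕ → ℝ) (K k : ℕ) (s : SeqOfRecord F ν M g K k) (V : GaugeField (F.P K) k (SU N)) :
    0 ≤ chiSeqOfRecord F N ν M g K k s V :=
  chi218_nonneg _ _ _ _ _ _ _ _ _

/-- `χ_k(s) ≤ 1` of record. [cite: Balaban1988Convergent, (2.17)–(2.18) p.257 (bookkeeping)] -/
theorem chiSeqOfRecord_le_one (M : ℕ) (g : ℕ → ℝ) (K k : ℕ) (s : SeqOfRecord F ν M g K k) (V : GaugeField (F.P K) k (SU N)) :
    chiSeqOfRecord F N ν M g K k s V ≤ 1 :=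
  chi218_le_one _ _ _ _ _ _ _ _ _

variable (τ : TowerNumerics)

/-- **THE STANDARD (0.3) PROVISOS OF THE TOWER OF RECORD, WRITTEN OUT** on the slot family `texpA` (consumer's instance): the summands
`χ_k(s)·slot(s)` measurable, non-negative, uniformly bounded, and every denominator fibre integral over `fibOfSeq s` of the `ppSel`-selected
summand NOWHERE zero (the conjunct refuted in the model for indicator-weighted pieces, dag-n12-a; (R-C2)). [cite: Balaban1989LargeFieldI, (0.3) p.176] -/
theorem provisos_towerRepOfRecord_iff (texpA : TexpAOfRecord F N ν τ.M) (ppSel : PpSelOfRecord F ν τ.M)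
    (p : B12.RunParams) (g : ℕ → ℝ) (k : ℕ) [DecidableEq (PBond (F.P p.K) k)] :
    (towerRepOfRecord F N ν τ texpA ppSel p g k).toRepData.Provisos ↔
      (∀ s, Measurable fun V => chiSeqOfRecord F N ν τ.M g p.K k s V * texpA p g k s V) ∧
      (∀ s V, 0 ≤ chiSeqOfRecord F N ν τ.M g p.K k s V * texpA p g k s V) ∧
      (∃ C : ℝ, ∀ s V, chiSeqOfRecord F N ν τ.M g p.K k s V * texpA p g k s V ≤ C) ∧
      ∀ s V, fibreIntegral (fibOfSeq F ν τ p g k s)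
          (fun V => chiSeqOfRecord F N ν τ.M g p.K k (ppSel p g k s) V * texpA p g k (ppSel p g k s) V) V ≠ 0 :=
  Iff.rfl

/-- **THE SUPPORT-FORM (0.3) PROVISOS OF THE TOWER OF RECORD, WRITTEN OUT** on the slot family `texpA` (consumer's instance): as above with
the last conjunct replaced by *«where that denominator fibre integral vanishes at `V`, `χ_k(s)(V)·slot(s)(V) = 0`»* — the reading of record.
[cite: Balaban1989LargeFieldI, (0.3) p.176] -/
theorem provisosSupp_towerRepOfRecord_iff (texpA : TexpAOfRecord F N ν τ.M) (ppSel : PpSelOfRecord F ν τ.M)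
    (p : B12.RunParams) (g : ℕ → ℝ) (k : ℕ) [DecidableEq (PBond (F.P p.K) k)] :
    (towerRepOfRecord F N ν τ texpA ppSel p g k).toRepData.ProvisosSupp ↔
      (∀ s, Measurable fun V => chiSeqOfRecord F N ν τ.M g p.K k s V * texpA p g k s V) ∧
      (∀ s V, 0 ≤ chiSeqOfRecord F N ν τ.M g p.K k s V * texpA p g k s V) ∧
      (∃ C : ℝ, ∀ s V, chiSeqOfRecord F N ν τ.M g p.K k s V * texpA p g k s V ≤ C) ∧
      ∀ s V, fibreIntegral (fibOfSeq F ν τ p g k s)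
          (fun V => chiSeqOfRecord F N ν τ.M g p.K k (ppSel p g k s) V * texpA p g k (ppSel p g k s) V) V = 0 →
        chiSeqOfRecord F N ν τ.M g p.K k s V * texpA p g k s V = 0 :=
  Iff.rfl

/-- **THE SUPPORT-FORM PROVISOS OF THE TOWER OF RECORD FROM DISPLAYED SLOT PROPERTIES**: `χ_k(s)` of record measurable (DISPLAYED — not
derivable, see the file header), the slots measurable with `0 ≤ slot(s) ≤ C`, and the support clause on the factors.
[cite: Balaban1989LargeFieldI, (0.3) p.176; Balaban1988Convergent, (2.17)–(2.18) p.257] -/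
theorem provisosSupp_towerRepOfRecord_of_slots (texpA : TexpAOfRecord F N ν τ.M) (ppSel : PpSelOfRecord F ν τ.M)
    (p : B12.RunParams) (g : ℕ → ℝ) (k : ℕ) [DecidableEq (PBond (F.P p.K) k)]
    (hχm : ∀ s, Measurable (chiSeqOfRecord F N ν τ.M g p.K k s)) (hTm : ∀ s, Measurable (texpA p g k s))
    (hT0 : ∀ s V, 0 ≤ texpA p g k s V) (hTC : ∃ C : ℝ, ∀ s V, texpA p g k s V ≤ C)
    (hsupp : ∀ s V, fibreIntegral (fibOfSeq F ν τ p g k s)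
        (fun V => chiSeqOfRecord F N ν τ.M g p.K k (ppSel p g k s) V * texpA p g k (ppSel p g k s) V) V = 0 →
      chiSeqOfRecord F N ν τ.M g p.K k s V = 0 ∨ texpA p g k s V = 0) :
    (towerRepOfRecord F N ν τ texpA ppSel p g k).toRepData.ProvisosSupp :=
  provisosSupp_repDataOfSel_of_factors (repr218OfRecord F N ν τ.M texpA p g k) (ppSel p g k) (fibOfSeq F ν τ p g k) hχm hTm
    (fun s V => chiSeqOfRecord_nonneg F N ν τ.M g p.K k s V) (fun s V => chiSeqOfRecord_le_one F N ν τ.M g p.K k s V) hT0 hTC hsupp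

/-- **ZERO SLOT FAMILY: the support-form (0.3) provisos of the tower of record HOLD** (junk inhabitant; plan's K0 direction for the
support-form `rstep`). [cite: Balaban1989LargeFieldI, (0.3) p.176 (bookkeeping)] -/
theorem provisosSupp_towerRepOfRecord_of_slot_eq_zero (texpA : TexpAOfRecord F N ν τ.M) (ppSel : PpSelOfRecord F ν τ.M)
    (p : B12.RunParams) (g : ℕ → ℝ) (k : ℕ) [DecidableEq (PBond (F.P p.K) k)] (h0 : ∀ s V, texpA p g k s V = 0) :
    (towerRepOfRecord F N ν τ texpA ppSel p g k).toRepData.ProvisosSupp :=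
  provisosSupp_repDataOfSel_of_TexpA_eq_zero (repr218OfRecord F N ν τ.M texpA p g k) (ppSel p g k) (fibOfSeq F ν τ p g k) h0

/-- **ZERO SLOT FAMILY: the standard-form (0.3) provisos of the tower of record FAIL** given one admissible sequence `s` and one field
`V` (the refuted-in-model 4th conjunct, here by pure bookkeeping; (R-C2)). [cite: Balaban1989LargeFieldI, (0.3) p.176 (bookkeeping)] -/
theorem not_provisos_towerRepOfRecord_of_slot_eq_zero (texpA : TexpAOfRecord F N ν τ.M) (ppSel : PpSelOfRecord F ν τ.M)
    (p : B12.RunParams) (g : ℕ → ℝ) (k : ℕ) [DecidableEq (PBond (F.P p.K) k)] (h0 : ∀ s V, texpA p g k s V = 0)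
    (s : SeqOfRecord F ν τ.M g p.K k) (V : GaugeField (F.P p.K) k (SU N)) :
    ¬ (towerRepOfRecord F N ν τ texpA ppSel p g k).toRepData.Provisos :=
  not_provisos_repDataOfSel_of_TexpA_eq_zero (repr218OfRecord F N ν τ.M texpA p g k) (ppSel p g k) (fibOfSeq F ν τ p g k) h0 s V

/-- **(0.4) AT A SLOT FAMILY FROM DISPLAYED SLOT PROPERTIES** (FILE 9′ `integral_densityOfSlice_rstepSlotOfRecord_of_provisosSupp` composed
with the reduction): the slice density of the R-stepped slot and the represented density have equal integrals. [cite: Balaban1989LargeFieldI, (0.4) p.176] -/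
theorem integral_densityOfSlice_rstepSlotOfRecord_of_slots (texpA : TexpAOfRecord F N ν τ.M) (ppSel : PpSelOfRecord F ν τ.M)
    (p : B12.RunParams) (g : ℕ → ℝ) (k : ℕ) [DecidableEq (PBond (F.P p.K) k)]
    (hχm : ∀ s, Measurable (chiSeqOfRecord F N ν τ.M g p.K k s)) (hTm : ∀ s, Measurable (texpA p g k s))
    (hT0 : ∀ s V, 0 ≤ texpA p g k s V) (hTC : ∃ C : ℝ, ∀ s V, texpA p g k s V ≤ C)
    (hsupp : ∀ s V, fibreIntegral (fibOfSeq F ν τ p g k s)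
        (fun V => chiSeqOfRecord F N ν τ.M g p.K k (ppSel p g k s) V * texpA p g k (ppSel p g k s) V) V = 0 →
      chiSeqOfRecord F N ν τ.M g p.K k s V = 0 ∨ texpA p g k s V = 0) :
    ∫ V, densityOfSlice F N ν τ.M p g k (rstepSlotOfRecord F N ν τ ppSel p g k (texpA p g k)) V ∂(fieldMeasure (F.P p.K) k (SU N))
      = ∫ V, densityOfRepr F N ν τ.M texpA p g k V ∂(fieldMeasure (F.P p.K) k (SU N)) :=
  integral_densityOfSlice_rstepSlotOfRecord_of_provisosSupp F N ν τ texpA ppSel p g k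
    (provisosSupp_towerRepOfRecord_of_slots F N ν τ texpA ppSel p g k hχm hTm hT0 hTC hsupp)

/-- **INTEGRABILITY OF THE R-STEPPED SLICE DENSITY FROM DISPLAYED SLOT PROPERTIES** (FILE 9′ `integrable_densityOfSlice_rstepSlotOfRecord_of_provisosSupp`
composed with the reduction). [cite: Balaban1989LargeFieldI, (0.3)–(0.4) p.176] -/
theorem integrable_densityOfSlice_rstepSlotOfRecord_of_slots (texpA : TexpAOfRecord F N ν τ.M) (ppSel : PpSelOfRecord F ν τ.M)
    (p : B12.RunParams) (g : ℕ → ℝ) (k : ℕ) [DecidableEq (PBond (F.P p.K) k)]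
    (hχm : ∀ s, Measurable (chiSeqOfRecord F N ν τ.M g p.K k s)) (hTm : ∀ s, Measurable (texpA p g k s))
    (hT0 : ∀ s V, 0 ≤ texpA p g k s V) (hTC : ∃ C : ℝ, ∀ s V, texpA p g k s V ≤ C)
    (hsupp : ∀ s V, fibreIntegral (fibOfSeq F ν τ p g k s)
        (fun V => chiSeqOfRecord F N ν τ.M g p.K k (ppSel p g k s) V * texpA p g k (ppSel p g k s) V) V = 0 →
      chiSeqOfRecord F N ν τ.M g p.K k s V = 0 ∨ texpA p g k s V = 0) :
    Integrable (densityOfSlice F N ν τ.M p g k (rstepSlotOfRecord F N ν τ ppSel p g k (texpA p g k))) (fieldMeasure (F.P p.K) k (SU N)) :=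
  integrable_densityOfSlice_rstepSlotOfRecord_of_provisosSupp F N ν τ texpA ppSel p g k
    (provisosSupp_towerRepOfRecord_of_slots F N ν τ texpA ppSel p g k hχm hTm hT0 hTC hsupp)

end Record

end Literature.MathematicalPhysics.QuantumFieldTheory.Balaban1983to89.Node00

end
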